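import Summits.BirchSwinnertonDyer.Rank1Residual.Additive.SignedTwistTransport
import Summits.BirchSwinnertonDyer.Rank1Residual.Additive.SignedTwistLocalTower
import Summits.BirchSwinnertonDyer.Rank1Residual.Additive.StrictSignedSelmer
import HarnessLib

/-!
# (P5-2b) The local points dictionary of the signed-`η` twist, I: the trace dictionary
# `Ψ ∘ Tr^W_{n/m} = Tr^V_{K₀ℚ_n/K₀ℚ_m} ∘ Ψ` (D4a) and `E^{−,0}_W(n) → E⁻_V(K_n)` (D4b1)
# (`cells/n1011/skel/T-O7ss-P5.md` §2 (D4a)(D4b))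
(cell `b2b-bsdres`, team n1011, seat n1011-p17 GEN 7; row T-O7ss-P13 follow-up (P5), file P5-2b;
designs (A)(B) APPROVED by referee-1 GEN 22)

HONEST FRAMING (cell `b2b-bsdres`, run/shared/lean/b2b/bsd-rank1-residual/, verbatim in every
file): the goal of the cell is to DELETE the COMBINATION-SHAPED residual classes of the
Birch–Swinnerton-Dyer formula for ALL analytic-rank `≤ 1` elliptic curves over `ℚ` — "full BSD
formula for every rank `≤ 1` curve in class `C`" assembled STRICTLY from published theorems — so
that the rank-`≤ 1` remainder becomes exactly the CONSTRUCTION-SHAPED classes, which are TYPED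
(missing-input `Prop`s), NOT attempted. This is not "finishing BSD". Research route on
O7-ss ∩ (G)∧ss ∩ e = 2 (OPEN) / X4 CONSTRUCTION-SHAPED; nothing here is booked; no label moves.
TOOL THEOREMS ONLY: no definition, no named Literature fact, no `sorry`; axioms standard.


Binders: `hD` = (D0) unfolded at `ι`; `hκ₀` = `κ(Gal(ℚ̄/K₀)) = ℤ_p` (RESHAPE, see P5-2a); `hη` pins
`η` by `t = rootInClosure K₀ θ`. No `p ≠ 2`.

## What is proved (`Ψ = localTransport … ι`, `U_n = towerSubgroup κ K₀ n`, `L_n = κ.layerSubgroup n`)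
* §5 `exists_equiv_towerQuotient_layerQuotient` (`Gal(K_{n,v}/K_{m,v}) ≃ Gal(ℚ_{n,p}/ℚ_{m,p})` at `ι`),
  **`localTransport_localTraceOfEmb`** ((D4a): `Ψ (Tr^W_{n/m} P) = Tr^V_{U_m/U_n} (Ψ P)` on `W(ℚ_n·E)`);
* §6 `localTransport_mem_localFixedPointsOfEmb` (+ `symm`), **`localTransport_mem_localFixedPoints_and_eigen`**
  (`W(ℚ_n·E) → V(K₀ℚ_n·E)^{η-eigen}`) and `localTransport_symm_mem_localLayerPointsOfEmb` (back),
  `mem_localLayerPointsOfEmb_of_tower_of_ker`, **`localTransport_mem_towerSigned`** ((D4b1): Def. 1.1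
  minus group + ZERO clause ⟹ cc-typer-6's verbatim `E⁻(K_{n,v})` with the `m = −1` clause),
  `localTransport_mem_towerSigned_of_two_nsmul` ((D4b1′): the exact preimage clause `2 • Tr_{n/0} = 0`).

References: S. Kobayashi, Invent. Math. 152 (2003) §2 p. 4, Def. 1.1, Def. 2.1 [Kobayashi2003].
-/

noncomputable section

open scoped Classical

open WeierstrassCurve Field

namespace Summit.BirchSwinnertonDyer.Rank1Residual.Additive.SignedTwist

open Literature.NumberTheory.EllipticCurves Literature.NumberTheory.GaloisRepresentations
  Literature.NumberTheory.EllipticCurves.Kobayashi2003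
  Summit.BirchSwinnertonDyer.Rank1Residual.AdditivePotMult

/-! ## §5 (D4a) The trace dictionary at `ι`: `Ψ ∘ Tr^W_{n/m} = Tr^V_{K₀ℚ_n/K₀ℚ_m} ∘ Ψ` on `W(ℚ_n·E)` -/

section TraceDictionary

open ZpExtension

variable (W : WeierstrassCurve ℚ) (K₀ : Type) [Field K₀] [NumberField K₀] {θ : K₀} {c : ℚ}
  (hθ : θ ∉ Set.range (algebraMap ℚ K₀)) (hc : θ ^ 2 = algebraMap ℚ K₀ c)
  {p : ℕ} [Fact p.Prime] (κ : ZpExtension ℚ p)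
  {V : WeierstrassCurve ℚ} {C : VariableChange ℚ} (hCV : C • W.quadraticTwist c = V)
  {E : Type} [Field E] [Algebra ℚ E] (ι : AlgebraicClosure ℚ →ₐ[ℚ] AlgebraicClosure E)

/-- `Gal(ℚ̄_E/K₀ℚ_m·E) ≤ Gal(ℚ̄_E/ℚ_m·E)`. [folklore] -/
theorem localSubgroupOfEmb_tower_le_layer (m : ℕ) :
    localSubgroupOfEmb (towerSubgroup κ K₀ m) ι ≤ localLayerSubgroupOfEmb κ ι m :=
  Subgroup.comap_mono fun σ hσ ↦ ((mem_towerSubgroup_iff κ K₀ m σ).mp hσ).1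

/-- Inside `Gal(ℚ̄_E/K₀ℚ_m·E)`, lying over `K₀ℚ_n` is the same as lying over `ℚ_n`. [folklore] -/
theorem subgroupOf_tower_eq_subgroupOf_layer (m n : ℕ) :
    (localSubgroupOfEmb (towerSubgroup κ K₀ n) ι).subgroupOf
        (localSubgroupOfEmb (towerSubgroup κ K₀ m) ι) =
      (localLayerSubgroupOfEmb κ ι n).subgroupOf (localSubgroupOfEmb (towerSubgroup κ K₀ m) ι) := by
  ext x
  rw [Subgroup.mem_subgroupOf, Subgroup.mem_subgroupOf, mem_localSubgroupOfEmb_iff,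
    mem_towerSubgroup_iff, localLayerSubgroupOfEmb, mem_localSubgroupOfEmb_iff]
  have hx : resGalOfEmb ι (x : absoluteGaloisGroup E) ∈ galRange (K := ℚ) K₀ :=
    ((mem_towerSubgroup_iff κ K₀ m _).mp ((mem_localSubgroupOfEmb_iff _ ι _).mp x.2)).2
  exact ⟨fun h ↦ h.1, fun h ↦ ⟨h, hx⟩⟩

/-- **The local Galois bookkeeping behind (D4a).** Under (D0) + `κ(Gal(ℚ̄/K₀)) = ℤ_p`, the inclusion
`Gal(ℚ̄_E/K₀ℚ_m·E) ↪ Gal(ℚ̄_E/ℚ_m·E)` induces a BIJECTION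
`Gal(ℚ̄_E/K₀ℚ_m·E)/Gal(ℚ̄_E/K₀ℚ_n·E) ≃ Gal(ℚ̄_E/ℚ_m·E)/Gal(ℚ̄_E/ℚ_n·E)` ("`Gal(K_{n,v}/K_{m,v}) =
Gal(ℚ_{n,p}/ℚ_{m,p})`"), compatible with `QuotientGroup.mk`. [folklore] -/
theorem exists_equiv_towerQuotient_layerQuotient
    (hD : ∀ g : absoluteGaloisGroup ℚ, ∃ τ : absoluteGaloisGroup E,
      (resGalOfEmb ι τ)⁻¹ * g ∈ towerTopSubgroup κ K₀)
    (hκ₀ : ∀ x, ∃ g ∈ galRange (K := ℚ) K₀, κ g = x) (m n : ℕ) :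
    ∃ e : localSubgroupOfEmb (towerSubgroup κ K₀ m) ι ⧸
        (localSubgroupOfEmb (towerSubgroup κ K₀ n) ι).subgroupOf
          (localSubgroupOfEmb (towerSubgroup κ K₀ m) ι) ≃
      localLayerSubgroupOfEmb κ ι m ⧸
        (localLayerSubgroupOfEmb κ ι n).subgroupOf (localLayerSubgroupOfEmb κ ι m),
      ∀ u : localSubgroupOfEmb (towerSubgroup κ K₀ m) ι,
        e (QuotientGroup.mk u) =
          QuotientGroup.mk (Subgroup.inclusion (localSubgroupOfEmb_tower_le_layer K₀ κ ι m) u) := by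
  set hUA := localSubgroupOfEmb_tower_le_layer K₀ κ ι m
  let f : localSubgroupOfEmb (towerSubgroup κ K₀ m) ι ⧸
        (localSubgroupOfEmb (towerSubgroup κ K₀ n) ι).subgroupOf
          (localSubgroupOfEmb (towerSubgroup κ K₀ m) ι) →
      localLayerSubgroupOfEmb κ ι m ⧸
        (localLayerSubgroupOfEmb κ ι n).subgroupOf (localLayerSubgroupOfEmb κ ι m) :=
    fun q ↦ Subgroup.quotientSubgroupOfEmbeddingOfLE (localLayerSubgroupOfEmb κ ι n) hUA
      (Subgroup.quotientEquivOfEq (subgroupOf_tower_eq_subgroupOf_layer K₀ κ ι m n) q)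
  have hf : ∀ u, f (QuotientGroup.mk u) = QuotientGroup.mk (Subgroup.inclusion hUA u) := fun u ↦ by
    simp only [f, Subgroup.quotientEquivOfEq_mk, Subgroup.quotientSubgroupOfEmbeddingOfLE_apply_mk]
  have hinj : Function.Injective f :=
    (Subgroup.quotientSubgroupOfEmbeddingOfLE _ hUA).injective.comp
      (Subgroup.quotientEquivOfEq _).injective
  have hsurj : Function.Surjective f := by
    intro q
    obtain ⟨a, rfl⟩ := QuotientGroup.mk_surjective q
    obtain ⟨u, hu, hk⟩ :=
      exists_mem_localSubgroupOfEmb_tower_inv_mul_mem_ker κ K₀ ι hD hκ₀ (m := m) a.2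
    refine ⟨QuotientGroup.mk ⟨u, hu⟩, ?_⟩
    rw [hf, QuotientGroup.eq, Subgroup.mem_subgroupOf]
    exact Subgroup.comap_mono (κ.kerSubgroup_le_layerSubgroup n) hk
  exact ⟨Equiv.ofBijective f ⟨hinj, hsurj⟩, hf⟩

/-- **(D4a) the trace dictionary**: for `P ∈ W(ℚ_n·E)`,
`Ψ (Tr^W_{n/m} P) = Tr^V_{K₀ℚ_n/K₀ℚ_m} (Ψ P)` — the `W`-side trace of Kobayashi Def. 1.1 over
the layers of `ℚ_∞` goes to cc-typer-6's `V`-side pair trace over the tower `K_n = K₀ℚ_n`: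
compute `Tr^W` with coset representatives chosen INSIDE `Gal(ℚ̄_E/K₀ℚ_m·E)`
(`exists_equiv_towerQuotient_layerQuotient`), on which `Ψ` is equivariant.
[cite: Kobayashi2003, §2 p. 4 (the trace maps Tr_{n/m+1})] -/
theorem localTransport_localTraceOfEmb
    (hD : ∀ g : absoluteGaloisGroup ℚ, ∃ τ : absoluteGaloisGroup E,
      (resGalOfEmb ι τ)⁻¹ * g ∈ towerTopSubgroup κ K₀)
    (hκ₀ : ∀ x, ∃ g ∈ galRange (K := ℚ) K₀, κ g = x) (m n : ℕ) {P : localPoints W E}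
    (hP : P ∈ localLayerPointsOfEmb κ ι W n) :
    localTransport W K₀ hθ hc hCV E ι (localTraceOfEmb κ ι W m n P) =
      localPairTraceOfEmb ι V (towerSubgroup κ K₀ m) (towerSubgroup κ K₀ n)
        (localTransport W K₀ hθ hc hCV E ι P) := by
  classical
  obtain ⟨e, he⟩ := exists_equiv_towerQuotient_layerQuotient K₀ κ ι hD hκ₀ m n
  set hUA := localSubgroupOfEmb_tower_le_layer K₀ κ ι m
  haveI : Fintype (localLayerSubgroupOfEmb κ ι m ⧸
      (localLayerSubgroupOfEmb κ ι n).subgroupOf (localLayerSubgroupOfEmb κ ι m)) := Fintype.ofFinite _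
  haveI : Fintype (localSubgroupOfEmb (towerSubgroup κ K₀ m) ι ⧸
      (localSubgroupOfEmb (towerSubgroup κ K₀ n) ι).subgroupOf
        (localSubgroupOfEmb (towerSubgroup κ K₀ m) ι)) := Fintype.ofFinite _
  have hs : ∀ q, (QuotientGroup.mk (Subgroup.inclusion hUA (e.symm q).out) : _ ⧸ _) = q := fun q ↦ by
    rw [← he, QuotientGroup.out_eq', Equiv.apply_symm_apply]
  rw [localTraceOfEmb_apply_eq_sum_of_mem κ ι W m n hP _ hs, ← Equiv.sum_comp e, map_sum,
    localPairTraceOfEmb_apply]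
  refine Finset.sum_congr rfl fun q _ ↦ ?_
  rw [Equiv.symm_apply_apply, Subgroup.coe_inclusion]
  exact localTransport_smul_of_mem W K₀ hθ hc hCV E ι (towerSubgroup_le_galRange κ K₀ m) _ P

end TraceDictionary

/-! ## §6 (D4b) The local points dictionary: `W`-side signed groups ↔ `η`-eigen `V`-side signed groups -/

section PointsDictionary

open ZpExtension

variable (W : WeierstrassCurve ℚ) (K₀ : Type) [Field K₀] [NumberField K₀] {θ : K₀} {c : ℚ}
  (hθ : θ ∉ Set.range (algebraMap ℚ K₀)) (hc : θ ^ 2 = algebraMap ℚ K₀ c)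
  {p : ℕ} [Fact p.Prime] (κ : ZpExtension ℚ p)
  {V : WeierstrassCurve ℚ} {C : VariableChange ℚ} (hCV : C • W.quadraticTwist c = V)
  {E : Type} [Field E] [Algebra ℚ E] (ι : AlgebraicClosure ℚ →ₐ[ℚ] AlgebraicClosure E)
  (η : absoluteGaloisGroup ℚ →* ℤˣ)
  (hη : ∀ σ : absoluteGaloisGroup ℚ, η σ = 1 ↔ σ • rootInClosure K₀ θ = rootInClosure K₀ θ)

/-- `Ψ` maps `H`-fixed points to `H`-fixed points for `H ≤ Gal(ℚ̄/K₀)`. [folklore] -/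
theorem localTransport_mem_localFixedPointsOfEmb {H : Subgroup (absoluteGaloisGroup ℚ)}
    (hH : H ≤ galRange (K := ℚ) K₀) {P : localPoints W E} (hP : P ∈ localFixedPointsOfEmb ι W H) :
    localTransport W K₀ hθ hc hCV E ι P ∈ localFixedPointsOfEmb ι V H := by
  rw [mem_localFixedPointsOfEmb_iff] at hP ⊢
  intro τ hτ
  rw [← localTransport_smul_of_smul_root_eq W K₀ hθ hc hCV E ι (apply_rootInClosure_of_mem K₀ (hH hτ)) P,
    hP τ hτ]

/-- … and conversely. [folklore] -/
theorem localTransport_symm_mem_localFixedPointsOfEmb {H : Subgroup (absoluteGaloisGroup ℚ)}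
    (hH : H ≤ galRange (K := ℚ) K₀) {S : localPoints V E} (hS : S ∈ localFixedPointsOfEmb ι V H) :
    (localTransport W K₀ hθ hc hCV E ι).symm S ∈ localFixedPointsOfEmb ι W H := by
  rw [mem_localFixedPointsOfEmb_iff] at hS ⊢
  intro τ hτ
  apply (localTransport W K₀ hθ hc hCV E ι).injective
  rw [AddEquiv.apply_symm_apply,
    localTransport_smul_of_smul_root_eq W K₀ hθ hc hCV E ι (apply_rootInClosure_of_mem K₀ (hH hτ)),
    AddEquiv.apply_symm_apply, hS τ hτ]

/-- `u • u • x = x` for a unit `u ∈ ℤˣ = {±1}`. [folklore] -/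
theorem units_smul_units_smul {A : Type*} [AddCommGroup A] (u : ℤˣ) (x : A) :
    ((u : ℤ) • (u : ℤ) • x) = x := by
  rw [smul_smul, ← Units.val_mul, Int.units_mul_self, Units.val_one, one_zsmul]

include hη in
/-- **(D4b) `W(ℚ_n·E) → V(K₀ℚ_n·E)^{η}`**: for `P ∈ W(ℚ_n·E)`, `Ψ P` is fixed by `Gal(ℚ̄_E/K₀ℚ_n·E)`
and is `η`-EIGEN under `Gal(ℚ̄_E/ℚ_n·E)`: `τ • Ψ P = η(res τ) · Ψ P`. [cite: Kobayashi2003, §2 p. 4] -/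
theorem localTransport_mem_localFixedPoints_and_eigen {n : ℕ} {P : localPoints W E}
    (hP : P ∈ localLayerPointsOfEmb κ ι W n) :
    localTransport W K₀ hθ hc hCV E ι P ∈ localFixedPointsOfEmb ι V (towerSubgroup κ K₀ n) ∧
      ∀ τ ∈ localLayerSubgroupOfEmb κ ι n,
        τ • localTransport W K₀ hθ hc hCV E ι P =
          ((η (resGalOfEmb ι τ) : ℤˣ) : ℤ) • localTransport W K₀ hθ hc hCV E ι P := by
  refine ⟨localTransport_mem_localFixedPointsOfEmb W K₀ hθ hc hCV ι (towerSubgroup_le_galRange κ K₀ n)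
    (localFixedPointsOfEmb_antitone ι W (localSubgroupOfEmb_tower_le_layer K₀ κ ι n |> fun h ↦ ?_) hP),
    fun τ hτ ↦ ?_⟩
  · exact fun σ hσ ↦ ((mem_towerSubgroup_iff κ K₀ n σ).mp hσ).1
  · have hfix : τ • P = P := (mem_localLayerPointsOfEmb_iff κ ι W n P).mp hP τ hτ
    have h := localTransport_smul W K₀ hθ hc hCV E ι η hη τ P
    rw [hfix] at h
    have h2 := congrArg (fun x ↦ ((η (resGalOfEmb ι τ) : ℤˣ) : ℤ) • x) h
    simp only [units_smul_units_smul] at h2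
    exact h2.symm

include hη in
/-- **… and back**: an `η`-eigenvector under `Gal(ℚ̄_E/ℚ_n·E)` pulls back to a point of `W(ℚ_n·E)`
(no (D0) needed). [cite: Kobayashi2003, §2 p. 4] -/
theorem localTransport_symm_mem_localLayerPointsOfEmb {n : ℕ} {S : localPoints V E}
    (hSη : ∀ τ ∈ localLayerSubgroupOfEmb κ ι n,
      τ • S = ((η (resGalOfEmb ι τ) : ℤˣ) : ℤ) • S) :
    (localTransport W K₀ hθ hc hCV E ι).symm S ∈ localLayerPointsOfEmb κ ι W n := by
  rw [mem_localLayerPointsOfEmb_iff]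
  intro τ hτ
  apply (localTransport W K₀ hθ hc hCV E ι).injective
  rw [localTransport_smul W K₀ hθ hc hCV E ι η hη τ, AddEquiv.apply_symm_apply, hSη τ hτ,
    units_smul_units_smul]

/-- A point fixed by `Gal(ℚ̄_E/K₀ℚ_m·E)` and by `Gal(ℚ̄_E/ℚ_∞·E)` is fixed by `Gal(ℚ̄_E/ℚ_m·E)`
((D0)(i)). [folklore] -/
theorem mem_localLayerPointsOfEmb_of_tower_of_ker
    (hD : ∀ g : absoluteGaloisGroup ℚ, ∃ τ : absoluteGaloisGroup E,
      (resGalOfEmb ι τ)⁻¹ * g ∈ towerTopSubgroup κ K₀)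
    (hκ₀ : ∀ x, ∃ g ∈ galRange (K := ℚ) K₀, κ g = x) {m : ℕ} {R : localPoints W E}
    (hU : R ∈ localFixedPointsOfEmb ι W (towerSubgroup κ K₀ m))
    (hker : R ∈ localFixedPointsOfEmb ι W κ.kerSubgroup) :
    R ∈ localLayerPointsOfEmb κ ι W m := by
  rw [mem_localLayerPointsOfEmb_iff]
  rw [mem_localFixedPointsOfEmb_iff] at hU hker
  have hle : localSubgroupOfEmb (κ.layerSubgroup m) ι ≤
      MulAction.stabilizer (absoluteGaloisGroup E) R := by
    rw [localSubgroupOfEmb_layer_eq_sup κ K₀ ι hD hκ₀ m]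
    exact sup_le (fun τ hτ ↦ hU τ hτ) (fun τ hτ ↦ hker τ hτ)
  exact fun τ hτ ↦ hle hτ

/-- Points of `W(ℚ_n·E)` are fixed by `Gal(ℚ̄_E/ℚ_∞·E)`. [folklore] -/
theorem mem_localFixedPointsOfEmb_ker_of_mem_layer {n : ℕ} {R : localPoints W E}
    (hR : R ∈ localLayerPointsOfEmb κ ι W n) : R ∈ localFixedPointsOfEmb ι W κ.kerSubgroup :=
  localFixedPointsOfEmb_antitone ι W (κ.kerSubgroup_le_layerSubgroup n) hR

/-- **(D4b1) `E^{−,0}_W(n) → E⁻_V(K_n)`**: a point of Kobayashi's Def. 1.1 minus group in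
`W`-coordinates whose trace to the bottom layer VANISHES goes to cc-typer-6's verbatim minus group
(WITH the `m = −1` clause) on the `V`-side. [cite: Kobayashi2003, §2 p. 4, Def. 1.1, Def. 2.1] -/
theorem localTransport_mem_towerSigned
    (hD : ∀ g : absoluteGaloisGroup ℚ, ∃ τ : absoluteGaloisGroup E,
      (resGalOfEmb ι τ)⁻¹ * g ∈ towerTopSubgroup κ K₀)
    (hκ₀ : ∀ x, ∃ g ∈ galRange (K := ℚ) K₀, κ g = x) {n : ℕ} {P : localPoints W E}
    (hP : P ∈ signedLocalPointsOfEmb κ ι W (-1) n) (h0 : localTraceOfEmb κ ι W 0 n P = 0) :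
    localTransport W K₀ hθ hc hCV E ι P ∈
      towerSignedLocalPointsOfEmb (towerSubgroup κ K₀) ι V (-1) n := by
  have hPn : P ∈ localLayerPointsOfEmb κ ι W n := signedLocalPointsOfEmb_le κ ι W (-1) n hP
  have hfixU : ∀ {m} {R : localPoints W E}, R ∈ localLayerPointsOfEmb κ ι W m →
      localTransport W K₀ hθ hc hCV E ι R ∈ localFixedPointsOfEmb ι V (towerSubgroup κ K₀ m) :=
    fun {m} {R} hR ↦ localTransport_mem_localFixedPointsOfEmb W K₀ hθ hc hCV ι
      (towerSubgroup_le_galRange κ K₀ m)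
      (localFixedPointsOfEmb_antitone ι W
        (fun σ hσ ↦ ((mem_towerSubgroup_iff κ K₀ m σ).mp hσ).1) hR)
  refine (mem_towerSignedLocalPointsOfEmb_iff _ ι V (-1) n _).mpr ⟨hfixU hPn, fun m hm hε ↦ ?_,
    fun _ ↦ ?_⟩
  · rw [← localTransport_localTraceOfEmb W K₀ hθ hc κ hCV ι hD hκ₀ (m + 1) n hPn]
    exact hfixU ((mem_signedLocalPointsOfEmb_iff κ ι W (-1) n P).mp hP |>.2 m hm hε)
  · rw [← localTransport_localTraceOfEmb W K₀ hθ hc κ hCV ι hD hκ₀ 0 n hPn, h0, map_zero]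
    exact zero_mem _

include hη in
/-- **(D4b1′)** the same with the WEAKER clause `2 • Tr_{n/0} P = 0`: then `Ψ(Tr_{n/0} P)` is still
`Γ_E`-fixed (it is `η`-eigen with `η = ±1` and equal to its own negative). This is the EXACT
preimage clause (`localTransport_symm_mem_signed_of_eigen`). [cite: Kobayashi2003, §2 p. 4] -/
theorem localTransport_mem_towerSigned_of_two_nsmul
    (hD : ∀ g : absoluteGaloisGroup ℚ, ∃ τ : absoluteGaloisGroup E,
      (resGalOfEmb ι τ)⁻¹ * g ∈ towerTopSubgroup κ K₀)
    (hκ₀ : ∀ x, ∃ g ∈ galRange (K := ℚ) K₀, κ g = x) {n : ℕ} {P : localPoints W E}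
    (hP : P ∈ signedLocalPointsOfEmb κ ι W (-1) n) (h0 : 2 • localTraceOfEmb κ ι W 0 n P = 0) :
    localTransport W K₀ hθ hc hCV E ι P ∈
      towerSignedLocalPointsOfEmb (towerSubgroup κ K₀) ι V (-1) n := by
  have hPn : P ∈ localLayerPointsOfEmb κ ι W n := signedLocalPointsOfEmb_le κ ι W (-1) n hP
  have hfixU : ∀ {m} {R : localPoints W E}, R ∈ localLayerPointsOfEmb κ ι W m →
      localTransport W K₀ hθ hc hCV E ι R ∈ localFixedPointsOfEmb ι V (towerSubgroup κ K₀ m) :=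
    fun {m} {R} hR ↦ localTransport_mem_localFixedPointsOfEmb W K₀ hθ hc hCV ι
      (towerSubgroup_le_galRange κ K₀ m)
      (localFixedPointsOfEmb_antitone ι W
        (fun σ hσ ↦ ((mem_towerSubgroup_iff κ K₀ m σ).mp hσ).1) hR)
  refine (mem_towerSignedLocalPointsOfEmb_iff _ ι V (-1) n _).mpr ⟨hfixU hPn, fun m hm hε ↦ ?_,
    fun _ ↦ ?_⟩
  · rw [← localTransport_localTraceOfEmb W K₀ hθ hc κ hCV ι hD hκ₀ (m + 1) n hPn]
    exact hfixU ((mem_signedLocalPointsOfEmb_iff κ ι W (-1) n P).mp hP |>.2 m hm hε)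
  · rw [← localTransport_localTraceOfEmb W K₀ hθ hc κ hCV ι hD hκ₀ 0 n hPn,
      mem_localFixedPointsOfEmb_top_iff]
    set T := localTraceOfEmb κ ι W 0 n P
    have hT : ∀ τ : absoluteGaloisGroup E, τ • T = T :=
      (mem_localLayerPointsOfEmb_zero_iff κ ι W T).mp (localTraceOfEmb_mem_of_mem κ ι W 0 n hPn)
    have hneg : -T = T := by
      rw [neg_eq_iff_add_eq_zero, ← two_nsmul]; exact h0
    intro τ
    have h := localTransport_smul W K₀ hθ hc hCV E ι η hη τ T
    rw [hT τ] at h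
    rcases Int.units_eq_one_or (η (resGalOfEmb ι τ)) with h1 | h1
    · rw [h1, Units.val_one, one_zsmul] at h; exact h.symm
    · rw [h1, Units.val_neg, Units.val_one, neg_one_zsmul] at h
      have h2 : τ • localTransport W K₀ hθ hc hCV E ι T = -localTransport W K₀ hθ hc hCV E ι T := by
        rw [eq_comm, neg_eq_iff_eq_neg]; exact h
      rw [h2, ← map_neg, hneg]

end PointsDictionary

end Summit.BirchSwinnertonDyer.Rank1Residual.Additive.SignedTwist
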